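import Literature.MathematicalPhysics.QuantumFieldTheory.Balaban1983to89.B9CoReadingCoords
import Literature.MathematicalPhysics.QuantumFieldTheory.Balaban1983to89.B9Eq352DivFormLetters
import Literature.MathematicalPhysics.QuantumFieldTheory.Balaban1983to89.B9SectBAllBlocksGeometryY
import Literature.MathematicalPhysics.QuantumFieldTheory.Balaban1983to89.B9Thm310Whole

/-!
# `Balaban1983to89.B9Local342GOfBlocksXBK` — T. Bałaban, *Propagators for lattice gauge theories in a background field*, Commun. Math. Phys. **99** (1985) 389–434
# [Balaban1985BackgroundPropagators], Thm 3.3 p. 399 with (3.42) p. 397 + Cor. 3.6 p. 408, BOND SECTOR, BLOCK-KEYED, ALL MEMBERS: [4]-(2.51) block majorants of the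
# coordinate conjugates of a bond-sector letter `O(U)` and of its composites with `∇_U`, `∇*_U`, `Δ_U` over the ALL-BLOCKS geometry `geoBK i`, keyed by the block map of
# the bond's initial point `y(b₋)` (`blkV1`), give the four block majorants of the certificate's bond models `GcoK … O U`, `DcoK ∘ GcoK`, `GcoK ∘ DscoK`, `LcoK ∘ GcoK` keyed by
# `(b, ν, a, c) ↦ y(b₋)` — the shapes of `B9Thm310Whole.Local342G` (rows 19 `h36A` of the pub-ymgap N06 certificate) at a block-keyed record; the bond-sector twin of
# `B9Local342OfBlocksXSK` (dag-lead WORDS 317 (2)(i), 2026-08-30)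

[4] = T. Bałaban, *Propagators and renormalization transformations for lattice gauge theories. II*, Commun. Math. Phys. **96** (1984) 223–250 [`Balaban1984PropagatorsII`].
statement-level skeleton of published theorems with citation tags; proofs where landed; nothing here is a claim about the Yang–Mills mass gap.

THE PRINT.  Thm 3.3 p. 399 (*«the operator G(U) (a = 1) satisfies the inequalities (3.42)–(3.47), with G′(U) replaced by G(U) and λ replaced by a function J defined at bonds»*);
(3.42) p. 397 (*«for x ∈ Δ(y), y ∈ Λ_j, supp λ ⊂ Δ(y′) … y, y′ ∈ 𝔅»*); Cor. 3.6 p. 408 + p. 409 l. 1–5 (the cube letters `G_□(U)` of the sequence `{Ω_n(□)}`); [4] (2.3) p. 224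
(*«Λ_j also denotes the set of bonds with at least one end-point in Λ_j»*), (2.45)–(2.46) p. 231, (2.51) p. 232, p. 248 (*«sites replaced by bonds»*).

WHY THIS FILE (cell `pub-ymgap`, node N06 [B9], seat `pub-ymgap-dag-n06-c` g23; LOCATED-28, rows 19).  Rows 19 of the N06 certificate display `h36A : Local342G (𝔬A x) …` for a
bond-sector record `𝔬A x : Ops310 (geo9Y x) …` INDEX-keyed by `blkBK (bI x)` (pins `hblkA hblkYA hDcoA hDscoA hLcoA`).  As on the site side (`B9Local342OfBlocksXSK`), the
all-members (3.42) supply is BLOCK-keyed: block majorants over the all-blocks geometry `geoBK i` (sites = all of `𝔅`), every bond read at the block `y(b₋) = blkV1 i.hN i.D b` of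
its initial point — print's own index ([4] p. 231 with p. 248), no bond map `bI`, no section of `β`.  THIS FILE is the bond twin of `B9Local342OfBlocksXSK`:
* §1 the carrier dictionary on ANY carrier (`coordOpK_apply_eq_conj_carrier`: n06-k's `coordOpK` at a slot `(ν, c)` is r06's `conj` on the slice) and the slicing of a
  block-supported bond coordinate vector (`blockSupp_sliceBK`);
* §2 the four block-keyed entries, generic in the letter `O : BondOpY 𝔸 i` and in the kernel `K`: ★★ `hasMajorant_GcoK_of_blocks` (`conj b G ≺ K`, `G = O(U)` ⟹
  `GcoK … O U ≺ c_R·K` keyed `(b, ν, a, c) ↦ y(b₋)`), ★★ `hasMajorantHom_DcoK_GcoK_of_blocks` (`conj b (D_ν)·conj b G ≺ K`, `D_ν = ∇_{U,ν}`), ★★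
  `hasMajorantHom_GcoK_DscoK_of_blocks` (`conj b G·conj b (D*_ν)`), ★★ `hasMajorantHom_LcoK_GcoK_of_blocks` (`conj b L·conj b G`, `L = Δ_U`) — the letter pins `hG hD hDs hL` are
  EXACTLY those of p21's bond writer `B9CubeLettersInvWriteDictB.eBlock_kernelFamilyBInv_of_hasMajorant` (so that a block-keyed twin of lit-balaban's bond Cor-3.6 chain
  `B9Cor36GCubeLocAtMember*` feeds them literally);
* §3 ★★ `local342G_of_blocks_pins` — `Local342G 𝔬 R H (c_R·B_c) δ U` for ANY block-keyed record `𝔬 : Ops310 (geoBK i) B (XBK κ i) (XBK κ i) ι A` whose blocks are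
  `(b, ν, a, c) ↦ y(b₋)` and whose `Gsq U j ∕ D U ∕ Dstar U ∕ Lap U` are `GcoK … (O j) U ∕ DcoK ∕ DscoK ∕ LcoK`, from per-cube block tables in the shapes of record
  (`B_c·ℓ(a)^{2,1,1,0}·e^{−δd}`).
The index-keyed face at the certificate's record (key transfer `y(b₋) ⟹ blkBK bI`) is the companion file `B9BlockKeyTransferXBK`.

HONEST SCOPE.  Dictionary algebra over landed readings (n06-k `B9CoReadingCoords`); the block tables are HYPOTHESES; nothing of [B9] asserted; COUNT-NEUTRAL; rows 19 NOT thereby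
derived; N06 NOT discharged; nothing continuum, nothing about the mass gap ∕ Clay.  A NEW file; 0 `def`, no `sorry`, no `axiom`, no `instance`, no `notation`.
`--supports stmt-QuantumFields-27364`.  Net new unproved facts: 0.

RELATED IN THE TREE, NOT DUPLICATED (searched 2026-08-30: `rg` for the basename and every decl name over `lean/Literature` + `lean/Summits` — 0 hits): `B9Local342OfBlocksXSK` (site
twin), `B9Local342GOfEBlockInvB` (same outputs from the `EBlock (kernelFamilyBInv …)` currency — section-carrying members only, LOCATED-28), `B9CubeLettersInvWriteDictB` (the
index-keyed writer, `ιB hι`).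
-/

noncomputable section

namespace Literature.MathematicalPhysics.QuantumFieldTheory.Balaban1983to89.B9Local342GOfBlocksXBK

open Node00 (FBondY CfgY BondOpY cdB cdsB lapB)
open B6GlobalChartV1 (blkV1)
open B6KLevelCensusIndexV1 (KIdx)
open B6RandomWalk (HasMajorant BlockSupp)
open B6RandomWalkHom (HasMajorantHom)
open B9Thm34Ext (toB6)
open B9SectBAllBlocksGeometryY (geoBK)
open B9Eq352DivFormLetters (conj conj_apply coordEquiv coordEquiv_symm_apply)
open B9Thm39ReadingCoords (cR39 cR39_nonneg)
open B9CoReadingCoords (XBK assembleK coordOpK coordOpK_apply GcoK DcoK DscoK LcoK DcoK_comp_GcoK GcoK_comp_DscoK LcoK_comp_GcoK cdBₗ cdsBₗ lapBₗ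
  cdBₗ_apply cdsBₗ_apply lapBₗ_apply)
open B9Thm310Whole (Ops310 Local342G)

variable {d ℓ : ℕ} {hd : 1 ≤ d + 1} {hL : Odd (ℓ + 1) ∧ 1 < ℓ + 1} {b₀ b₁ : ℝ}
variable {𝔸 : Type} [NormedRing 𝔸] [NormedAlgebra ℂ 𝔸] [CompleteSpace 𝔸] [FiniteDimensional ℝ 𝔸]
variable {κ : Type} [Fintype κ]

/-! ## §1 The carrier dictionary (any carrier) and the slicing of a block-supported bond coordinate vector -/

section Dictionary

variable (b : Module.Basis κ ℝ 𝔸)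

omit [CompleteSpace 𝔸] [FiniteDimensional ℝ 𝔸] in
/-- ★ **THE CARRIER DICTIONARY ON ANY CARRIER `S`**: at the slot `(ν, c)` the κ-fold coordinate model reads r06's conjugate on the slice — `(coordOpK b T F)(s, ν, a, c) =
(conj b (T ν) (λ (w, j), F (w, ν, j, c)))(s, a)` (both are `repr_a` of `T ν` applied to `Σ_j F(·, ν, j, c)·b_j`).  (`B9Local342OfBlocksXSK.coordOpK_apply_eq_conj` is the case
`S = SiteY i`.) [cite: Balaban1984PropagatorsII, (2.51) p.232, p.248 («sites replaced by bonds»); Balaban1985BackgroundPropagators, (3.42) p.397, dictionary] -/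
theorem coordOpK_apply_eq_conj_carrier {S D : Type} (T : D → (S → 𝔸) →ₗ[ℝ] (S → 𝔸)) (F : S × D × κ × κ → ℝ) (s : S) (ν : D) (a c : κ) :
    coordOpK b T F (s, ν, a, c) = conj b (T ν) (fun p : S × κ => F (p.1, ν, p.2, c)) (s, a) := by
  have hΛ : (coordEquiv b).symm (fun p : S × κ => F (p.1, ν, p.2, c)) = assembleK b ν c F := by
    funext w
    rw [coordEquiv_symm_apply]
    rfl
  rw [coordOpK_apply, conj_apply, hΛ]

variable (i : KIdx d ℓ hd hL b₀ b₁) [Fintype (geoBK i).Site] {R₀ : ℝ} {H₀ : Prop}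

omit [NormedAlgebra ℂ 𝔸] [CompleteSpace 𝔸] [FiniteDimensional ℝ 𝔸] [Fintype κ] in
/-- **slicing a block-supported bond coordinate vector**: if `F` on the carrier `XBK` is supported over `{q : y(q.1₋) = y′}` with `|F| ≤ Bd` there, every slice
`(w, j) ↦ F (w, ν, j, c)` is supported over `{(w, j) : y(w₋) = y′}` with the same bound. [cite: Balaban1984PropagatorsII, (2.51) p.232 («supp λ ⊂ B^{j′}(y′)»), bookkeeping] -/
theorem blockSupp_sliceBK {y' : (geoBK i).Site} {F : XBK κ i → ℝ} {Bd : ℝ}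
    (hF : BlockSupp (g := toB6 (geoBK i) R₀ H₀) (fun q : XBK κ i => blkV1 i.hN i.D q.1) F y' Bd) (ν : Fin (d + 1)) (c : κ) :
    BlockSupp (g := toB6 (geoBK i) R₀ H₀) (fun p : FBondY i × κ => blkV1 i.hN i.D p.1) (fun p : FBondY i × κ => F (p.1, ν, p.2, c)) y' Bd :=
  ⟨hF.nonneg, fun p hp => hF.bound (p.1, ν, p.2, c) hp, fun p hp => hF.off (p.1, ν, p.2, c) hp⟩

end Dictionary

/-! ## §2 The four block-keyed entries, bond sector -/

section Entries

variable (i : KIdx d ℓ hd hL b₀ b₁) [Fintype (geoBK i).Site] (b : Module.Basis κ ℝ 𝔸)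
variable (B : B9.Backgrounds) (cfg : B.Cfg → CfgY 𝔸 i) (O : BondOpY 𝔸 i)
variable {R₀ : ℝ} {H₀ : Prop} {U₁ : B.Cfg}

/-- ★★ **ENTRY (3.42)₁, BOND SECTOR, BLOCK-KEYED** — *«|(G(U)J)(x)| ≦ B₀(Lʲη)²e^{−δ₀d(y,y′)}|J|»*: a block majorant `K` of `conj b G`, `G = O(U)`, over the all-blocks geometry keyed
by `(b, j) ↦ y(b₋)` gives the block majorant `c_R·K` of the model letter `GcoK … O U` keyed by `(b, ν, a, c) ↦ y(b₋)` — every member, no section.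
[cite: Balaban1985BackgroundPropagators, Thm 3.3 p.399, (3.42) p.397, Cor. 3.6 p.408; Balaban1984PropagatorsII, (2.51) p.232, (2.45) p.231, p.248] -/
theorem hasMajorant_GcoK_of_blocks (G : Module.End ℝ (FBondY i → 𝔸)) (hG : ∀ Λ, G Λ = O (cfg U₁) Λ) {K : (geoBK i).Site → (geoBK i).Site → ℝ}
    (h0 : HasMajorant (g := toB6 (geoBK i) R₀ H₀) (fun p : FBondY i × κ => blkV1 i.hN i.D p.1) (conj b G) K) :
    HasMajorant (g := toB6 (geoBK i) R₀ H₀) (fun q : XBK κ i => blkV1 i.hN i.D q.1) (GcoK i b B cfg O U₁) (fun s s' => cR39 b * K s s') := by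
  have hGO : G = (O (cfg U₁)).restrictScalars ℝ := LinearMap.ext fun Λ => hG Λ
  intro y' F Bd hF q
  obtain ⟨x, ν, a, c⟩ := q
  have hpt := h0 y' _ Bd (blockSupp_sliceBK i (R₀ := R₀) (H₀ := H₀) hF ν c) (x, a)
  have hval : GcoK i b B cfg O U₁ F (x, ν, a, c) = cR39 b * conj b G (fun p : FBondY i × κ => F (p.1, ν, p.2, c)) (x, a) := by
    rw [GcoK, LinearMap.smul_apply, Pi.smul_apply, smul_eq_mul, coordOpK_apply_eq_conj_carrier, hGO]
  show |GcoK i b B cfg O U₁ F (x, ν, a, c)| ≤ cR39 b * K (blkV1 i.hN i.D x) y' * Bd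
  rw [hval, abs_mul, abs_of_nonneg (cR39_nonneg b), mul_assoc]
  exact mul_le_mul_of_nonneg_left hpt (cR39_nonneg b)

/-- ★★ **ENTRY (3.42)₂, BOND SECTOR, BLOCK-KEYED** — *«|(∇_UG(U)J)(x)| ≦ B₀(Lʲη)e^{−δ₀d(y,y′)}|J|»*: block majorants `K` of `conj b (D_ν)·conj b G` for every `ν` (`D_ν = ∇_{U,ν}`,
`G = O(U)`) give the block majorant `c_R·K` of `DcoK ∘ GcoK` keyed by `y(b₋)`. [cite: Balaban1985BackgroundPropagators, Thm 3.3 p.399, (3.42) p.397, (3.3) p.390; Balaban1984PropagatorsII, (2.51) p.232] -/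
theorem hasMajorantHom_DcoK_GcoK_of_blocks (G : Module.End ℝ (FBondY i → 𝔸)) (hG : ∀ Λ, G Λ = O (cfg U₁) Λ)
    (D : Fin (d + 1) → Module.End ℝ (FBondY i → 𝔸)) (hD : ∀ ν Λ, D ν Λ = cdB i (cfg U₁) ν Λ) {K : (geoBK i).Site → (geoBK i).Site → ℝ}
    (h1 : ∀ ν : Fin (d + 1), HasMajorant (g := toB6 (geoBK i) R₀ H₀) (fun p : FBondY i × κ => blkV1 i.hN i.D p.1) (conj b (D ν) * conj b G) K) :
    HasMajorantHom (g := toB6 (geoBK i) R₀ H₀) (fun q : XBK κ i => blkV1 i.hN i.D q.1) (fun q : XBK κ i => blkV1 i.hN i.D q.1)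
      (DcoK i b B cfg U₁ ∘ₗ GcoK i b B cfg O U₁) (fun s s' => cR39 b * K s s') := by
  have hDG : ∀ ν, D ν * G = cdBₗ i (cfg U₁) ν ∘ₗ (O (cfg U₁)).restrictScalars ℝ := fun ν =>
    LinearMap.ext fun Λ => by rw [Module.End.mul_apply, hG, hD, LinearMap.comp_apply, cdBₗ_apply]; rfl
  intro y' F Bd hF q
  obtain ⟨x, ν, a, c⟩ := q
  have h1' := h1 ν
  rw [← B9Eq352DivFormLetters.conj_mul, hDG ν] at h1'
  have hpt := h1' y' _ Bd (blockSupp_sliceBK i (R₀ := R₀) (H₀ := H₀) hF ν c) (x, a)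
  have hval : (DcoK i b B cfg U₁ ∘ₗ GcoK i b B cfg O U₁) F (x, ν, a, c) =
      cR39 b * conj b (cdBₗ i (cfg U₁) ν ∘ₗ (O (cfg U₁)).restrictScalars ℝ) (fun p : FBondY i × κ => F (p.1, ν, p.2, c)) (x, a) := by
    rw [DcoK_comp_GcoK, LinearMap.smul_apply, Pi.smul_apply, smul_eq_mul, coordOpK_apply_eq_conj_carrier]
  show |(DcoK i b B cfg U₁ ∘ₗ GcoK i b B cfg O U₁) F (x, ν, a, c)| ≤ cR39 b * K (blkV1 i.hN i.D x) y' * Bd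
  rw [hval, abs_mul, abs_of_nonneg (cR39_nonneg b), mul_assoc]
  exact mul_le_mul_of_nonneg_left hpt (cR39_nonneg b)

/-- ★★ **ENTRY (3.42)₃, BOND SECTOR, BLOCK-KEYED** — *«|(G(U)∇*_UJ)(x)| ≦ B₀(Lʲη)e^{−δ₀d(y,y′)}|J|»*: block majorants `K` of `conj b G·conj b (D*_ν)` for every `ν` (`D*_ν = ∇*_{U,ν}`)
give the block majorant `c_R·K` of `GcoK ∘ DscoK` keyed by `y(b₋)`. [cite: Balaban1985BackgroundPropagators, Thm 3.3 p.399, (3.42) p.397, (3.8) p.392; Balaban1984PropagatorsII, (2.51) p.232] -/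
theorem hasMajorantHom_GcoK_DscoK_of_blocks (G : Module.End ℝ (FBondY i → 𝔸)) (hG : ∀ Λ, G Λ = O (cfg U₁) Λ)
    (Ds : Fin (d + 1) → Module.End ℝ (FBondY i → 𝔸)) (hDs : ∀ ν Λ, Ds ν Λ = cdsB i (cfg U₁) ν Λ) {K : (geoBK i).Site → (geoBK i).Site → ℝ}
    (h2 : ∀ ν : Fin (d + 1), HasMajorant (g := toB6 (geoBK i) R₀ H₀) (fun p : FBondY i × κ => blkV1 i.hN i.D p.1) (conj b G * conj b (Ds ν)) K) :
    HasMajorantHom (g := toB6 (geoBK i) R₀ H₀) (fun q : XBK κ i => blkV1 i.hN i.D q.1) (fun q : XBK κ i => blkV1 i.hN i.D q.1)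
      (GcoK i b B cfg O U₁ ∘ₗ DscoK i b B cfg U₁) (fun s s' => cR39 b * K s s') := by
  have hGD : ∀ ν, G * Ds ν = (O (cfg U₁)).restrictScalars ℝ ∘ₗ cdsBₗ i (cfg U₁) ν := fun ν =>
    LinearMap.ext fun Λ => by rw [Module.End.mul_apply, hG, hDs, LinearMap.comp_apply, cdsBₗ_apply]; rfl
  intro y' F Bd hF q
  obtain ⟨x, ν, a, c⟩ := q
  have h2' := h2 ν
  rw [← B9Eq352DivFormLetters.conj_mul, hGD ν] at h2'
  have hpt := h2' y' _ Bd (blockSupp_sliceBK i (R₀ := R₀) (H₀ := H₀) hF ν c) (x, a)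
  have hval : (GcoK i b B cfg O U₁ ∘ₗ DscoK i b B cfg U₁) F (x, ν, a, c) =
      cR39 b * conj b ((O (cfg U₁)).restrictScalars ℝ ∘ₗ cdsBₗ i (cfg U₁) ν) (fun p : FBondY i × κ => F (p.1, ν, p.2, c)) (x, a) := by
    rw [GcoK_comp_DscoK, LinearMap.smul_apply, Pi.smul_apply, smul_eq_mul, coordOpK_apply_eq_conj_carrier]
  show |(GcoK i b B cfg O U₁ ∘ₗ DscoK i b B cfg U₁) F (x, ν, a, c)| ≤ cR39 b * K (blkV1 i.hN i.D x) y' * Bd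
  rw [hval, abs_mul, abs_of_nonneg (cR39_nonneg b), mul_assoc]
  exact mul_le_mul_of_nonneg_left hpt (cR39_nonneg b)

/-- ★★ **ENTRY (3.42)₄, BOND SECTOR, BLOCK-KEYED** — *«|(Δ_UG(U)J)(x)| ≦ B₀e^{−δ₀d(y,y′)}|J|»*: a block majorant `K` of `conj b L·conj b G` (`L = Δ_U`, `G = O(U)`) gives the block
majorant `c_R·K` of `LcoK ∘ GcoK` keyed by `y(b₋)`. [cite: Balaban1985BackgroundPropagators, Thm 3.3 p.399, (3.42) p.397, (3.23) p.394; Balaban1984PropagatorsII, (2.51) p.232] -/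
theorem hasMajorantHom_LcoK_GcoK_of_blocks (G L : Module.End ℝ (FBondY i → 𝔸)) (hG : ∀ Λ, G Λ = O (cfg U₁) Λ) (hL : ∀ Λ, L Λ = lapB i (cfg U₁) Λ)
    {K : (geoBK i).Site → (geoBK i).Site → ℝ}
    (h3 : HasMajorant (g := toB6 (geoBK i) R₀ H₀) (fun p : FBondY i × κ => blkV1 i.hN i.D p.1) (conj b L * conj b G) K) :
    HasMajorantHom (g := toB6 (geoBK i) R₀ H₀) (fun q : XBK κ i => blkV1 i.hN i.D q.1) (fun q : XBK κ i => blkV1 i.hN i.D q.1)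
      (LcoK i b B cfg U₁ ∘ₗ GcoK i b B cfg O U₁) (fun s s' => cR39 b * K s s') := by
  have hLG : L * G = lapBₗ i (cfg U₁) ∘ₗ (O (cfg U₁)).restrictScalars ℝ :=
    LinearMap.ext fun Λ => by rw [Module.End.mul_apply, hG, hL, LinearMap.comp_apply, lapBₗ_apply]; rfl
  intro y' F Bd hF q
  obtain ⟨x, ν, a, c⟩ := q
  rw [← B9Eq352DivFormLetters.conj_mul, hLG] at h3
  have hpt := h3 y' _ Bd (blockSupp_sliceBK i (R₀ := R₀) (H₀ := H₀) hF ν c) (x, a)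
  have hval : (LcoK i b B cfg U₁ ∘ₗ GcoK i b B cfg O U₁) F (x, ν, a, c) =
      cR39 b * conj b (lapBₗ i (cfg U₁) ∘ₗ (O (cfg U₁)).restrictScalars ℝ) (fun p : FBondY i × κ => F (p.1, ν, p.2, c)) (x, a) := by
    rw [LcoK_comp_GcoK, LinearMap.smul_apply, Pi.smul_apply, smul_eq_mul, coordOpK_apply_eq_conj_carrier]
  show |(LcoK i b B cfg U₁ ∘ₗ GcoK i b B cfg O U₁) F (x, ν, a, c)| ≤ cR39 b * K (blkV1 i.hN i.D x) y' * Bd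
  rw [hval, abs_mul, abs_of_nonneg (cR39_nonneg b), mul_assoc]
  exact mul_le_mul_of_nonneg_left hpt (cR39_nonneg b)

end Entries

/-! ## §3 `Local342G` of a block-keyed bond record from the per-cube block tables -/

section Transport

variable {G : B6.Geometry} {X Y : Type}

/-- a block majorant transported along equalities of the block map and of the operator. [folklore] -/
private theorem hasMajorant_of_pins {blk blk' : X → G.Site} {T T' : Module.End ℝ (X → ℝ)} {K : G.Site → G.Site → ℝ} (hb : blk = blk') (hT : T = T')
    (h : HasMajorant (g := G) blk' T' K) : HasMajorant (g := G) blk T K := by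
  subst hb hT
  exact h

/-- a two-block majorant transported along equalities of the block maps and of the operator. [folklore] -/
private theorem hasMajorantHom_of_pins {blkX blkX' : X → G.Site} {blkY blkY' : Y → G.Site} {T T' : (X → ℝ) →ₗ[ℝ] (Y → ℝ)} {K : G.Site → G.Site → ℝ}
    (hX : blkX = blkX') (hY : blkY = blkY') (hT : T = T') (h : HasMajorantHom (g := G) blkX' blkY' T' K) : HasMajorantHom (g := G) blkX blkY T K := by
  subst hX hY hT
  exact h

end Transport

section Record

variable (i : KIdx d ℓ hd hL b₀ b₁) [Fintype (geoBK i).Site] (b : Module.Basis κ ℝ 𝔸)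
variable (B : B9.Backgrounds) (cfg : B.Cfg → CfgY 𝔸 i)
variable {R₀ : ℝ} {H₀ : Prop} {U₁ : B.Cfg}

/-- ★★ **`Local342G` AT THE BLOCK-KEYED PINS, BOND SECTOR** — p. 409 «the operators G_□(U) … satisfy all the inequalities of Theorems 3.1–3.3», every member, no section: for a
letter record `𝔬 : Ops310 (geoBK i) …` over the bond coordinate carrier whose blocks are `(b, ν, a, c) ↦ y(b₋)` and whose fields `Gsq U j ∕ D U ∕ Dstar U ∕ Lap U` are the models
`GcoK … (O j) U ∕ DcoK ∕ DscoK ∕ LcoK`, the per-cube block tables h0–h3 (letters pinned as in p21's bond writer: `G j = O_j(U)`, `D_ν = ∇_{U,ν}`, `D*_ν = ∇*_{U,ν}`, `L = Δ_U`; one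
pair `(B_c, δ)`) give `Local342G 𝔬 R H (c_R·B_c) δ U`.
[cite: Balaban1985BackgroundPropagators, Thm 3.3 p.399, Cor. 3.6 p.408 + p.409, (3.42) p.397, (3.87) p.409; Balaban1984PropagatorsII, (2.51) p.232, p.248] -/
theorem local342G_of_blocks_pins {ι A : Type} (Oc : ι → BondOpY 𝔸 i) (𝔬 : Ops310 (geoBK i) B (XBK κ i) (XBK κ i) ι A)
    (hblk : 𝔬.blk = fun q : XBK κ i => blkV1 i.hN i.D q.1) (hblkY : 𝔬.blkY = fun q : XBK κ i => blkV1 i.hN i.D q.1)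
    (hGsq : ∀ j, 𝔬.Gsq U₁ j = GcoK i b B cfg (Oc j) U₁)
    (hD : 𝔬.D U₁ = DcoK i b B cfg U₁) (hDs : 𝔬.Dstar U₁ = DscoK i b B cfg U₁) (hLap : 𝔬.Lap U₁ = LcoK i b B cfg U₁)
    (G : ι → Module.End ℝ (FBondY i → 𝔸)) (hG : ∀ j Λ, G j Λ = Oc j (cfg U₁) Λ)
    (D Ds : Fin (d + 1) → Module.End ℝ (FBondY i → 𝔸)) (hDl : ∀ ν Λ, D ν Λ = cdB i (cfg U₁) ν Λ) (hDsl : ∀ ν Λ, Ds ν Λ = cdsB i (cfg U₁) ν Λ)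
    (L : Module.End ℝ (FBondY i → 𝔸)) (hL : ∀ Λ, L Λ = lapB i (cfg U₁) Λ) {Bc δ : ℝ}
    (h0 : ∀ j, HasMajorant (g := toB6 (geoBK i) R₀ H₀) (fun p : FBondY i × κ => blkV1 i.hN i.D p.1) (conj b (G j))
      (fun s s' => Bc * (geoBK i).len s ^ 2 * Real.exp (-(δ * (geoBK i).dist s s'))))
    (h1 : ∀ j (ν : Fin (d + 1)), HasMajorant (g := toB6 (geoBK i) R₀ H₀) (fun p : FBondY i × κ => blkV1 i.hN i.D p.1) (conj b (D ν) * conj b (G j))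
      (fun s s' => Bc * (geoBK i).len s * Real.exp (-(δ * (geoBK i).dist s s'))))
    (h2 : ∀ j (ν : Fin (d + 1)), HasMajorant (g := toB6 (geoBK i) R₀ H₀) (fun p : FBondY i × κ => blkV1 i.hN i.D p.1) (conj b (G j) * conj b (Ds ν))
      (fun s s' => Bc * (geoBK i).len s * Real.exp (-(δ * (geoBK i).dist s s'))))
    (h3 : ∀ j, HasMajorant (g := toB6 (geoBK i) R₀ H₀) (fun p : FBondY i × κ => blkV1 i.hN i.D p.1) (conj b L * conj b (G j))
      (fun s s' => Bc * 1 * Real.exp (-(δ * (geoBK i).dist s s')))) :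
    Local342G 𝔬 R₀ H₀ (cR39 b * Bc) δ U₁ := by
  have e0 : ∀ j, HasMajorant (g := toB6 (geoBK i) R₀ H₀) (fun q : XBK κ i => blkV1 i.hN i.D q.1) (GcoK i b B cfg (Oc j) U₁)
      (fun s s' => cR39 b * Bc * (geoBK i).len s ^ 2 * Real.exp (-(δ * (geoBK i).dist s s'))) := fun j => by
    have h := hasMajorant_GcoK_of_blocks i b B cfg (Oc j) (R₀ := R₀) (H₀ := H₀) (G j) (hG j) (h0 j)
    simpa only [mul_assoc] using h
  have e1 : ∀ j, HasMajorantHom (g := toB6 (geoBK i) R₀ H₀) (fun q : XBK κ i => blkV1 i.hN i.D q.1) (fun q : XBK κ i => blkV1 i.hN i.D q.1)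
      (DcoK i b B cfg U₁ ∘ₗ GcoK i b B cfg (Oc j) U₁) (fun s s' => cR39 b * Bc * (geoBK i).len s * Real.exp (-(δ * (geoBK i).dist s s'))) := fun j => by
    have h := hasMajorantHom_DcoK_GcoK_of_blocks i b B cfg (Oc j) (R₀ := R₀) (H₀ := H₀) (G j) (hG j) D hDl (h1 j)
    simpa only [mul_assoc] using h
  have e2 : ∀ j, HasMajorantHom (g := toB6 (geoBK i) R₀ H₀) (fun q : XBK κ i => blkV1 i.hN i.D q.1) (fun q : XBK κ i => blkV1 i.hN i.D q.1)
      (GcoK i b B cfg (Oc j) U₁ ∘ₗ DscoK i b B cfg U₁) (fun s s' => cR39 b * Bc * (geoBK i).len s * Real.exp (-(δ * (geoBK i).dist s s'))) := fun j => by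
    have h := hasMajorantHom_GcoK_DscoK_of_blocks i b B cfg (Oc j) (R₀ := R₀) (H₀ := H₀) (G j) (hG j) Ds hDsl (h2 j)
    simpa only [mul_assoc] using h
  have e3 : ∀ j, HasMajorantHom (g := toB6 (geoBK i) R₀ H₀) (fun q : XBK κ i => blkV1 i.hN i.D q.1) (fun q : XBK κ i => blkV1 i.hN i.D q.1)
      (LcoK i b B cfg U₁ ∘ₗ GcoK i b B cfg (Oc j) U₁) (fun s s' => cR39 b * Bc * Real.exp (-(δ * (geoBK i).dist s s'))) := fun j => by
    have h := hasMajorantHom_LcoK_GcoK_of_blocks i b B cfg (Oc j) (R₀ := R₀) (H₀ := H₀) (G j) L (hG j) hL (h3 j)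
    simpa only [mul_one, mul_assoc] using h
  refine ⟨fun j => ?_, fun j => ?_, fun j => ?_, fun j => ?_⟩
  · exact hasMajorant_of_pins hblk (by rw [hGsq]) (e0 j)
  · exact hasMajorantHom_of_pins hblk hblkY (by rw [hD, hGsq]) (e1 j)
  · exact hasMajorantHom_of_pins hblkY hblk (by rw [hDs, hGsq]) (e2 j)
  · exact hasMajorantHom_of_pins hblk hblk (by rw [hLap, hGsq]) (e3 j)

end Record

end Literature.MathematicalPhysics.QuantumFieldTheory.Balaban1983to89.B9Local342GOfBlocksXBK
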